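import Literature.Analysis.FluidPDE.BoundedRepresentative
import Literature.Analysis.FluidPDE.KNSSBlowupLimit
import Literature.Analysis.FluidPDE.KatoLocalL3Exists
import Literature.Analysis.FluidPDE.MildL3RestartAveraging
import Literature.Analysis.FluidPDE.KatoLocalLeraySlab
import Literature.Analysis.FluidPDE.SuitableWeakPressure
import HarnessLib

/-!
# Kato solutions are weak solutions on the open slab (mild ⇒ weak in `C([0,T); L³)`)

Analysis/FluidPDE proof file (theorems only) in the DAG below the named fact
`Literature.Analysis.FluidPDE.kato_distributional_slab` (**D** of `KatoLocalLerayPressure.lean`: a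
Kato solution solves the Navier–Stokes equations in the sense of distributions on the open slab
with the Riesz pressure). Step **D-w** of the plan: the *pressure-free* half of the distributional
equations, i.e. the momentum equation tested with divergence-free fields, and the divergence
constraint, together with the local integrability of `u` and `|u|²` on the open slab:

* `IsKatoSolutionOn.integral_weakForm_eq_zero` — for a Kato solution `u` on `[0, T)`, `ν > 0`,
  and every test field `ψ ∈ C_c^∞((0,T) × ℝ³; ℝ³)` with divergence-free slices,
  `∫₀ᵀ ∫ (⟪u, ∂ₜψ⟫ + ⟪u, (u·∇)ψ⟫ + ν⟪u, Δψ⟫) = 0` (Fabes–Jones–Rivière 1972, Thm. 2.1, (ii) ⇒ (i);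
  Lemarié-Rieusset 2016, Def. 6.2: very weak solutions). Proof by the tree's bridges: the time
  support of `ψ` is some `[a, b] ⊂ (0, T)`; by the restart theorem (`mild_L3_restart_holds`,
  `isMildNSSolutionOn_translate_of_restart`) the translate `u(· + a/2)` is a duality-form mild
  solution from `u(a/2)` on `[0, T' - a/2)`, `b < T' < T`, essentially bounded there by Kato's
  smoothing bound (`mild_L3_interior_bounded_holds`), so it agrees slice-wise a.e. with a bounded
  weak solution in the sense of Koch–Nadirashvili–Seregin–Šverák
  (`exists_isBoundedWeakNSSolutionOn_of_isMildNSSolutionOn`, resting on `ForwardMildWeak.lean`);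
  test with `ψ(· + a/2)` (`IsSpaceTimeTestOn.comp_add_time`) and shift the time variable back;
* `IsKatoSolutionOn.setIntegral_inner_gradient_eq_zero` — `∫∫ ⟪u, ∇ₓθ⟫ = 0` for scalar tests
  on the slab (slice-wise weak divergence-freeness and Fubini);
* `IsKatoSolutionOn.locallyIntegrableOn_slab`, `.locallyIntegrableOn_norm_sq_slab`,
  `.memLp_three_strip` — `u ∈ L³((0,S) × ℝ³)` for `S < T`, hence `u`, `|u|²` are locally
  integrable on the open slab.

## Mathlib / tree search

Tree: `exists_isBoundedWeakNSSolutionOn_of_isMildNSSolutionOn` (`BoundedRepresentative.lean`),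
`IsSpaceTimeTestOn.exists_time_support_Ioo` (`ForwardMildWeak.lean`),
`weakIntegrand_eq_zero_of_notMem` (`KNSSBlowupLimit.lean`), `timeDeriv_eq_zero_of_time_support`
(`HeatDuhamelBack.lean`), `IsSpaceTimeTestOn.comp_sub_time` (`LerayHopfRestart.lean`, the model of
`comp_add_time`), `aestronglyMeasurable_uncurry_translate`, `isMildNSSolutionOn_translate_of_restart`
(`MildL3Smooth.lean`) with `mild_L3_restart_holds`, `mild_L3_interior_bounded_holds`,
`IsSpaceTimeTestOn.continuous_gradient_field`, `integrable_inner_of_locallyIntegrableOn`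
(`SuitableWeakPressure.lean`), `IsKatoSolutionOn.sqIntegrable_slab`,
`lintegral_strip_enorm_rpow_three_lt_top` (`KatoLocalLeraySlab.lean`). Mathlib:
`integral_add_right_eq_self`, `setIntegral_eq_integral_of_forall_compl_eq_zero`, `integral_prod`,
`locallyIntegrableOn_iff`.

## References

* E. B. Fabes, B. F. Jones, N. M. Rivière, *The initial value problem for the Navier–Stokes
  equations with data in `L^p`*, Arch. Rational Mech. Anal. 45 (1972), Thm. 2.1.
  [FabesJonesRiviere1972]
* P. G. Lemarié-Rieusset, *The Navier–Stokes problem in the 21st century*, CRC Press 2016,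
  Def. 6.2 (file p. 126), (6.13) (p. 135). [LemarieRieusset2016]
* G. Koch, N. Nadirashvili, G. Seregin, V. Šverák, Acta Math. 203 (2009), §4 (ii).
  [KochNadirashviliSereginSverak2009]
* L. Caffarelli, R. Kohn, L. Nirenberg, CPAM 35 (1982), §2 (2.2). [CaffarelliKohnNirenberg1982]
-/

noncomputable section

open MeasureTheory TopologicalSpace Set Function Filter Topology Metric
open scoped ENNReal NNReal RealInnerProductSpace Laplacian

namespace Literature.Analysis.FluidPDE

/-! ## Time shifts of space–time test fields -/

section Shift

variable {E : Type*} [NormedAddCommGroup E] [NormedSpace ℝ E]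
variable {F' : Type*} [NormedAddCommGroup F'] [NormedSpace ℝ F']

/-- **Forward time shift of a test field.** If `ψ` is a test field on the open slab `(α, β) × E`,
then `(t, x) ↦ ψ(t + s, x)` is a test field on the open slab `(α - s, β - s) × E` (composition
with the homeomorphism `(t, x) ↦ (t + s, x)`). [folklore] -/
theorem IsSpaceTimeTestOn.comp_add_time {α β s : ℝ} {ψ : ℝ → E → F'}
    (hψ : IsSpaceTimeTestOn (slab E (Ioo α β) isOpen_Ioo) ψ) :
    IsSpaceTimeTestOn (slab E (Ioo (α - s) (β - s)) isOpen_Ioo) (fun t x => ψ (t + s) x) := by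
  set θ : ℝ × E ≃ₜ ℝ × E := (Homeomorph.addRight s).prodCongr (Homeomorph.refl E) with hθ
  have hθap : ∀ z : ℝ × E, θ z = (z.1 + s, z.2) := fun z => by
    obtain ⟨t, x⟩ := z
    simp [hθ]
  have hfun : (uncurry fun t x => ψ (t + s) x) = uncurry ψ ∘ θ := by
    funext z
    simp only [comp_apply, hθap, uncurry]
  have hsupp : tsupport (uncurry ψ ∘ θ) = θ ⁻¹' tsupport (uncurry ψ) := by
    rw [tsupport, tsupport, support_comp_eq_preimage, θ.preimage_closure]
  refine ⟨?_, ?_, ?_⟩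
  · exact hψ.contDiff.comp ((contDiff_fst.add contDiff_const).prodMk contDiff_snd)
  · rw [hfun]
    exact hψ.hasCompactSupport.comp_homeomorph θ
  · rw [hfun, hsupp]
    intro z hz
    have h1 : θ z ∈ (slab E (Ioo α β) isOpen_Ioo : Set (ℝ × E)) := hψ.tsupport_subset hz
    have h2 : z.1 + s ∈ Ioo α β := by
      have := mem_slab.1 h1
      rwa [hθap] at this
    exact mem_slab.2 ⟨by linarith [h2.1], by linarith [h2.2]⟩

omit [NormedAddCommGroup E] [NormedSpace ℝ E] in
/-- The time derivative commutes with the forward time shift: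
`∂ₜ[ψ(· + s)](t, x) = (∂ₜψ)(t + s, x)`. [folklore] -/
theorem timeDeriv_comp_add_time (ψ : ℝ → E → F') (s t : ℝ) (x : E) :
    timeDeriv (fun τ y => ψ (τ + s) y) t x = timeDeriv ψ (t + s) x := by
  simp only [timeDeriv_apply]
  exact deriv_comp_add_const (fun τ => ψ τ x) s t

/-- A test field with time support in `[a, b]` is a test field on every open slab `(α, β) × E` with
`α < a`, `b < β`. [folklore] -/
theorem IsSpaceTimeTestOn.of_time_support_Ioo {Q : Opens (ℝ × E)} {ψ : ℝ → E → F'}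
    (hψ : IsSpaceTimeTestOn Q ψ) {a b α β : ℝ} (hsupp : ∀ t, t ∉ Icc a b → ψ t = 0)
    (hα : α < a) (hβ : b < β) : IsSpaceTimeTestOn (slab E (Ioo α β) isOpen_Ioo) ψ := by
  refine ⟨hψ.contDiff, hψ.hasCompactSupport, ?_⟩
  have hsub : support (uncurry ψ) ⊆ Icc a b ×ˢ (univ : Set E) := fun z hz => by
    refine ⟨?_, mem_univ _⟩
    by_contra h
    exact hz (by simp only [uncurry, hsupp z.1 h, Pi.zero_apply])
  refine (closure_minimal hsub (isClosed_Icc.prod isClosed_univ)).trans fun z hz => ?_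
  exact mem_slab.2 ⟨hα.trans_le hz.1.1, hz.1.2.trans_lt hβ⟩

end Shift

/-! ## The weak formulation of a Kato solution on the open slab -/

section Weak

local notation "ℝ³" => EuclideanSpace ℝ (Fin 3)

variable {T ν : ℝ} {u₀ : ℝ³ → ℝ³} {u : ℝ → ℝ³ → ℝ³}

/-- **Kato solutions are weak solutions on the open slab** (Fabes–Jones–Rivière 1972, Thm. 2.1,
(ii) ⇒ (i): a solution of the integral equation in `L^{p,q}` is a weak solution; Lemarié-Rieusset
2016, Def. 6.2 and (6.13): very weak solutions, tested with divergence-free fields). Let `u` be a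
Kato solution on `[0, T)` with viscosity `ν > 0` (`IsKatoSolutionOn`: the duality-form mild
solution in `C([0,T); L³)`). Then for every smooth compactly supported test field `ψ` on the open
slab `(0, T) × ℝ³` with divergence-free slices,
`∫₀ᵀ ∫ (⟪u, ∂ₜψ⟫ + ⟪u, (u·∇)ψ⟫ + ν ⟪u, Δψ⟫) dx dt = 0`.
Proof: the time support of `ψ` lies in `[a, b] ⊂ (0, T)`; restart the solution at `s = a/2`
(`mild_L3_restart_holds`, `isMildNSSolutionOn_translate_of_restart`): the translate
`v = u(· + s)` is a mild solution from `u(s)` on `[0, T' - s)`, `b < T' < T`, essentially bounded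
there by Kato's smoothing bound `‖u(t)‖_∞ ≤ C/√t ≤ |C|/√s` (`mild_L3_interior_bounded_holds`), hence
agrees slice-wise a.e. with a bounded weak solution in the sense of Koch–Nadirashvili–Seregin–Šverák
(`exists_isBoundedWeakNSSolutionOn_of_isMildNSSolutionOn`, the tree's mild ⇒ weak bridge
`ForwardMildWeak.lean`); test it with the shifted field `ψ(· + s)` and shift back.
[cite: FabesJonesRiviere1972, Thm. 2.1] [cite: LemarieRieusset2016, Def. 6.2 and (6.13) (pp. 126, 135)] -/
theorem IsKatoSolutionOn.integral_weakForm_eq_zero (hν : 0 < ν) (hu : IsKatoSolutionOn T ν u₀ u)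
    {ψ : ℝ → ℝ³ → ℝ³} (hψ : IsSpaceTimeTestOn (slab ℝ³ (Ioo 0 T) isOpen_Ioo) ψ)
    (hdiv : ∀ t, VectorCalculus.IsDivFree (ψ t)) :
    ∫ t in Ioo 0 T, ∫ x, (⟪u t x, timeDeriv ψ t x⟫ + ⟪u t x, convect (u t) (ψ t) x⟫ +
      ν * ⟪u t x, (Δ (ψ t)) x⟫) = 0 := by
  rcases le_or_gt T 0 with hT0 | hT
  · simp [Ioo_eq_empty_of_le hT0]
  obtain ⟨a, b, ha, hab, hbT, hsupp⟩ := hψ.exists_time_support_Ioo hT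
  have hu₀ : MemLp u₀ 3 volume := hu.memLp_initial hT
  have hdiv₀ : IsWeaklyDivFree u₀ := hu.isWeaklyDivFree_initial hT
  -- times: `s = a/2`, `b < T' < T`, `T₁ = T' - s`
  set s : ℝ := a / 2 with hs
  have hs0 : 0 < s := by positivity
  have hsa : s < a := by rw [hs]; linarith
  set T' : ℝ := (b + T) / 2 with hT'
  have hbT' : b < T' := by rw [hT']; linarith
  have hT'T : T' < T := by rw [hT']; linarith
  set T₁ : ℝ := T' - s with hT₁
  have hT₁pos : 0 < T₁ := by rw [hT₁]; linarith
  -- the weak integrand as a function of time, and its vanishing off `[a, b]`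
  set F : ℝ → ℝ := fun t => ∫ x, (⟪u t x, timeDeriv ψ t x⟫ + ⟪u t x, convect (u t) (ψ t) x⟫ +
    ν * ⟪u t x, (Δ (ψ t)) x⟫) with hF
  have hF0 : ∀ t, t ∉ Icc a b → F t = 0 := fun t ht => by
    simp only [hF, weakIntegrand_eq_zero_of_notMem hsupp ht (u t) ν, integral_zero]
  -- the translate `v = u(· + s)` is a mild solution from `u s` on `[0, T₁)`
  set v : ℝ → ℝ³ → ℝ³ := fun t => u (t + s) with hv
  have hsT : s ∈ Ico 0 T := ⟨hs0.le, hsa.trans (hab.trans_lt hbT)⟩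
  have hvmild : IsMildNSSolutionOn (Ico 0 T₁) ν 0 (v 0) v := by
    have h := isMildNSSolutionOn_translate_of_restart mild_L3_restart_holds hν hT hu₀ hu.mild
      hu.continuousInLpOn hu.aestronglyMeasurable hsT
    have e : v 0 = u s := by simp only [hv, zero_add]
    rw [e]
    exact h.mono (Ico_subset_Ico_right (by rw [hT₁]; linarith))
  -- Kato's smoothing bound makes `v` essentially bounded on `[0, T₁)`
  obtain ⟨C, hC⟩ := mild_L3_interior_bounded_holds hν hT hu₀ hdiv₀ hu.mild hu.continuousInLpOn
    hu.aestronglyMeasurable T' ⟨hs0.trans (hsa.trans (hab.trans_lt hbT')), hT'T⟩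
  have hb : ∀ t ∈ Ico 0 T₁, eLpNorm (v t) ∞ volume ≤ ENNReal.ofReal (|C| / Real.sqrt s) := by
    intro t ht
    have hts : t + s ∈ Ioo 0 T' := ⟨by linarith [ht.1], by rw [hT₁] at ht; linarith [ht.2]⟩
    refine (hC (t + s) hts).trans (ENNReal.ofReal_le_ofReal ?_)
    have hsqrt : Real.sqrt s ≤ Real.sqrt (t + s) := Real.sqrt_le_sqrt (by linarith [ht.1])
    calc C / Real.sqrt (t + s) ≤ |C| / Real.sqrt (t + s) :=
          div_le_div_of_nonneg_right (le_abs_self C) (Real.sqrt_nonneg _)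
      _ ≤ |C| / Real.sqrt s :=
          div_le_div_of_nonneg_left (abs_nonneg C) (Real.sqrt_pos.2 hs0) hsqrt
  have hsl : ∀ t ∈ Ico 0 T₁, AEStronglyMeasurable (v t) volume := fun t ht =>
    (hu.memLp ⟨by linarith [ht.1], by rw [hT₁] at ht; linarith [ht.2]⟩).1
  have hvm : AEStronglyMeasurable (uncurry v) (volume.restrict (Ioo 0 T₁ ×ˢ univ)) :=
    (aestronglyMeasurable_uncurry_translate hs0.le hu.aestronglyMeasurable).mono_measure
      (Measure.restrict_mono (Set.prod_mono (Ioo_subset_Ioo_right (by rw [hT₁]; linarith))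
        Subset.rfl) le_rfl)
  obtain ⟨w, hwv, hw⟩ := exists_isBoundedWeakNSSolutionOn_of_isMildNSSolutionOn hν hT₁pos hvmild
    ENNReal.ofReal_lt_top hb hsl hvm
  -- the shifted test field on the slab `(0, T₁)`
  set ψ' : ℝ → ℝ³ → ℝ³ := fun t x => ψ (t + s) x with hψ'
  have hsupp' : ∀ t, t ∉ Icc (a - s) (b - s) → ψ' t = 0 := fun t ht => by
    have h : t + s ∉ Icc a b := fun h' => ht ⟨by linarith [h'.1], by linarith [h'.2]⟩
    funext x
    simp only [hψ', hsupp (t + s) h, Pi.zero_apply]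
  have hψ'test : IsSpaceTimeTestOn (slab ℝ³ (Ioo 0 T₁) isOpen_Ioo) ψ' :=
    (hψ.comp_add_time (s := s)).of_time_support_Ioo hsupp' (by linarith) (by rw [hT₁]; linarith)
  have hdiv' : ∀ t, VectorCalculus.IsDivFree (ψ' t) := fun t => hdiv (t + s)
  have key := hw.2.2.2 ψ' hψ'test hdiv'
  -- replace the bounded representative `w` by `v = u(· + s)` slice-wise
  have key2 : ∫ t in Ioo 0 T₁, F (t + s) = 0 := by
    have e : ∫ t in Ioo 0 T₁, F (t + s) = ∫ t in Ioo 0 T₁, ∫ x, (⟪w t x, timeDeriv ψ' t x⟫ +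
        ⟪w t x, convect (w t) (ψ' t) x⟫ + ν * ⟪w t x, (Δ (ψ' t)) x⟫) := by
      refine setIntegral_congr_fun measurableSet_Ioo fun t ht => ?_
      simp only [hF]
      refine integral_congr_ae ?_
      filter_upwards [hwv t ⟨ht.1.le, ht.2⟩] with x hx
      simp only [hψ', timeDeriv_comp_add_time, convect, hx, hv]
    rw [e]
    exact key
  -- shift the time variable back and restore the time domain `(0, T)`
  have hvan1 : ∀ t, t ∉ Ioo 0 T₁ → F (t + s) = 0 := fun t ht => by
    refine hF0 (t + s) fun h => ht ⟨?_, ?_⟩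
    · linarith [h.1]
    · rw [hT₁]; linarith [h.2]
  have hvan2 : ∀ t, t ∉ Ioo 0 T → F t = 0 := fun t ht =>
    hF0 t fun h => ht ⟨ha.trans_le h.1, h.2.trans_lt hbT⟩
  calc ∫ t in Ioo 0 T, F t = ∫ t, F t := setIntegral_eq_integral_of_forall_compl_eq_zero hvan2
    _ = ∫ t, F (t + s) := (integral_add_right_eq_self (μ := (volume : Measure ℝ)) F s).symm
    _ = ∫ t in Ioo 0 T₁, F (t + s) := (setIntegral_eq_integral_of_forall_compl_eq_zero hvan1).symm
    _ = 0 := key2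

/-- The same on a shorter slab: for `S ≤ T` and a test field on `(0, S) × ℝ³` with divergence-free
slices, `∫₀ˢ ∫ (⟪u, ∂ₜψ⟫ + ⟪u, (u·∇)ψ⟫ + ν⟪u, Δψ⟫) = 0` (restriction `IsKatoSolutionOn.mono`).
[cite: FabesJonesRiviere1972, Thm. 2.1] -/
theorem IsKatoSolutionOn.integral_weakForm_eq_zero_of_le (hν : 0 < ν) (hu : IsKatoSolutionOn T ν u₀ u)
    {S : ℝ} (hST : S ≤ T) {ψ : ℝ → ℝ³ → ℝ³}
    (hψ : IsSpaceTimeTestOn (slab ℝ³ (Ioo 0 S) isOpen_Ioo) ψ)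
    (hdiv : ∀ t, VectorCalculus.IsDivFree (ψ t)) :
    ∫ t in Ioo 0 S, ∫ x, (⟪u t x, timeDeriv ψ t x⟫ + ⟪u t x, convect (u t) (ψ t) x⟫ +
      ν * ⟪u t x, (Δ (ψ t)) x⟫) = 0 :=
  (hu.mono hST).integral_weakForm_eq_zero hν hψ hdiv

end Weak

/-! ## Local integrability on the open slab and the weak divergence constraint -/

section LocInt

local notation "ℝ³" => EuclideanSpace ℝ (Fin 3)

variable {T ν : ℝ} {u₀ : ℝ³ → ℝ³} {u : ℝ → ℝ³ → ℝ³}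

/-- A compact subset of the open slab `(0, T) × ℝ³` lies in a closed box `(0, S) × B̄_R(0)` with
`S < T` (indeed with times `≥ a > 0`, not needed here). [folklore] -/
theorem exists_strip_closedBall_of_isCompact {K : Set (ℝ × ℝ³)} (hK : IsCompact K)
    (hKQ : K ⊆ Ioo 0 T ×ˢ (univ : Set ℝ³)) :
    ∃ S R : ℝ, S < T ∧ K ⊆ Ioo 0 S ×ˢ closedBall (0 : ℝ³) R := by
  rcases K.eq_empty_or_nonempty with rfl | hne
  · exact ⟨T - 1, 0, by linarith, empty_subset _⟩
  obtain ⟨zmax, hzmaxK, hzmax⟩ := hK.exists_isMaxOn hne continuous_fst.continuousOn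
  have hzT : zmax.1 < T := (hKQ hzmaxK).1.2
  obtain ⟨R, hR⟩ := (hK.image continuous_snd).isBounded.subset_closedBall (0 : ℝ³)
  refine ⟨(zmax.1 + T) / 2, R, by linarith, fun z hz => ⟨⟨(hKQ hz).1.1, ?_⟩, hR (mem_image_of_mem _ hz)⟩⟩
  have h := hzmax hz
  simp only at h
  change z.1 ≤ zmax.1 at h
  linarith

/-- **A Kato solution is in `L³` of every strip `(0, S) × ℝ³`, `S < T`** (as a `MemLp` statement).
[folklore] -/
theorem IsKatoSolutionOn.memLp_three_strip (hu : IsKatoSolutionOn T ν u₀ u) {S : ℝ} (hS : S < T) :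
    MemLp (uncurry u) 3 (volume.restrict (Ioo 0 S ×ˢ (univ : Set ℝ³))) := by
  refine ⟨(hu.mono hS.le).aestronglyMeasurable, ?_⟩
  rw [eLpNorm_eq_lintegral_rpow_enorm_toReal (by norm_num) (by norm_num)]
  simp only [ENNReal.toReal_ofNat, one_div]
  refine ENNReal.rpow_lt_top_of_nonneg (by norm_num) ?_
  exact (hu.lintegral_strip_enorm_rpow_three_lt_top hS).ne

/-- **Local integrability of a Kato solution on the open slab** `(0, T) × ℝ³` (every compact
subset lies in a strip `(0, S) × B̄_R`, `S < T`, of finite measure, where `u ∈ L³ ⊂ L¹`).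
[folklore] -/
theorem IsKatoSolutionOn.locallyIntegrableOn_slab (hu : IsKatoSolutionOn T ν u₀ u) :
    LocallyIntegrableOn (uncurry u) (Ioo 0 T ×ˢ (univ : Set ℝ³)) volume := by
  have hopen : IsOpen (Ioo (0 : ℝ) T ×ˢ (univ : Set ℝ³)) := isOpen_Ioo.prod isOpen_univ
  refine (locallyIntegrableOn_iff hopen.isLocallyClosed).2 fun K hKQ hK => ?_
  obtain ⟨S, R, hST, hKbox⟩ := exists_strip_closedBall_of_isCompact hK hKQ
  have hKstrip : K ⊆ Ioo 0 S ×ˢ (univ : Set ℝ³) := hKbox.trans (Set.prod_mono Subset.rfl (subset_univ _))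
  have hmem : MemLp (uncurry u) 3 (volume.restrict K) := by
    have h := (hu.memLp_three_strip hST).restrict K
    rwa [Measure.restrict_restrict hK.measurableSet, inter_eq_left.2 hKstrip] at h
  haveI : IsFiniteMeasure (volume.restrict K) := ⟨by rw [Measure.restrict_apply_univ]; exact hK.measure_lt_top⟩
  exact hmem.integrable (by norm_num)

/-- **Local integrability of `|u|²` on the open slab** (on a strip `(0, S) × K₂`, `S < T`, `K₂`
compact, `∫∫ |u|² < ∞` by `|u|² ≤ 1 + |u|³`, `IsKatoSolutionOn.sqIntegrable_slab`). [folklore] -/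
theorem IsKatoSolutionOn.locallyIntegrableOn_norm_sq_slab (hu : IsKatoSolutionOn T ν u₀ u) :
    LocallyIntegrableOn (fun z : ℝ × ℝ³ => ‖uncurry u z‖ ^ 2) (Ioo 0 T ×ˢ (univ : Set ℝ³)) volume := by
  have hopen : IsOpen (Ioo (0 : ℝ) T ×ˢ (univ : Set ℝ³)) := isOpen_Ioo.prod isOpen_univ
  refine (locallyIntegrableOn_iff hopen.isLocallyClosed).2 fun K hKQ hK => ?_
  obtain ⟨S, R, hST, hKbox⟩ := exists_strip_closedBall_of_isCompact hK hKQ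
  have hKstrip : K ⊆ Ioo 0 S ×ˢ (univ : Set ℝ³) := hKbox.trans (Set.prod_mono Subset.rfl (subset_univ _))
  have hm : AEStronglyMeasurable (fun z : ℝ × ℝ³ => ‖uncurry u z‖ ^ 2) (volume.restrict K) :=
    (((hu.mono hST.le).aestronglyMeasurable.mono_measure
      (Measure.restrict_mono hKstrip le_rfl)).norm.pow 2)
  refine ⟨hm, ?_⟩
  show ∫⁻ z in K, ‖‖uncurry u z‖ ^ 2‖ₑ < ∞
  calc ∫⁻ z in K, ‖‖uncurry u z‖ ^ 2‖ₑ = ∫⁻ z in K, ‖u z.1 z.2‖ₑ ^ 2 :=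
        lintegral_congr fun z => by
          rw [Real.enorm_eq_ofReal (sq_nonneg _), ENNReal.ofReal_pow (norm_nonneg _), ofReal_norm]; rfl
    _ ≤ ∫⁻ z in Ioo 0 S ×ˢ closedBall (0 : ℝ³) R, ‖u z.1 z.2‖ₑ ^ 2 := lintegral_mono_set hKbox
    _ < ∞ := hu.sqIntegrable_slab hST _ (isCompact_closedBall _ _)

/-- **The weak divergence constraint on the slab**: for a Kato solution `u` and every scalar test
function `θ ∈ C_c^∞((0,T) × ℝ³)`, `∫∫ ⟪u, ∇ₓθ⟫ dx dt = 0` (the slices `u(t)` are weakly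
divergence free, `IsMildNSSolutionOn`, and Fubini; this is the divergence conjunct of
`IsDistributionalNSSolutionOn`, Caffarelli–Kohn–Nirenberg 1982, (2.2)).
[cite: CaffarelliKohnNirenberg1982, §2 (2.2)] -/
theorem IsKatoSolutionOn.setIntegral_inner_gradient_eq_zero (hu : IsKatoSolutionOn T ν u₀ u)
    {θ : ℝ → ℝ³ → ℝ} (hθ : IsSpaceTimeTestOn (slab ℝ³ (Ioo 0 T) isOpen_Ioo) θ) :
    ∫ z in Ioo 0 T ×ˢ (univ : Set ℝ³), ⟪u z.1 z.2, gradient (θ z.1) z.2⟫ = 0 := by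
  obtain ⟨hwc, -, hw0⟩ := hθ.continuous_gradient_field
  have hKQ : tsupport (uncurry θ) ⊆ ((slab ℝ³ (Ioo 0 T) isOpen_Ioo : Opens (ℝ × ℝ³)) : Set (ℝ × ℝ³)) :=
    hθ.tsupport_subset
  have hI : Integrable (fun z : ℝ × ℝ³ => ⟪u z.1 z.2, gradient (θ z.1) z.2⟫) (volume : Measure (ℝ × ℝ³)) :=
    integrable_inner_of_locallyIntegrableOn (Q := slab ℝ³ (Ioo 0 T) isOpen_Ioo)
      hu.locallyIntegrableOn_slab hwc hθ.hasCompactSupport hKQ hw0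
  -- the integrand vanishes off the slab: pass to the whole space–time and apply Fubini
  have hvan : ∀ z : ℝ × ℝ³, z ∉ Ioo 0 T ×ˢ (univ : Set ℝ³) → ⟪u z.1 z.2, gradient (θ z.1) z.2⟫ = 0 :=
    fun z hz => by rw [hw0 z fun h => hz (hKQ h), inner_zero_right]
  rw [setIntegral_eq_integral_of_forall_compl_eq_zero hvan,
    show (volume : Measure (ℝ × ℝ³)) = (volume : Measure ℝ).prod (volume : Measure ℝ³) from rfl,
    integral_prod _ hI]
  -- every slice integral vanishes
  have hslice : ∀ t, ∫ x, ⟪u t x, gradient (θ t) x⟫ = 0 := by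
    intro t
    by_cases ht : t ∈ Ioo 0 T
    · exact hu.mild.1 t ⟨ht.1.le, ht.2⟩ (θ t) ((hθ.mono le_top).isTestFunctionOn_slice t)
    · refine integral_eq_zero_of_ae (Eventually.of_forall fun x => ?_)
      have hz : ((t, x) : ℝ × ℝ³) ∉ tsupport (uncurry θ) := fun h => ht (mem_slab.1 (hKQ h))
      simp only [hw0 (t, x) hz, inner_zero_right, Pi.zero_apply]
  simp only [hslice, integral_zero]

end LocInt

end Literature.Analysis.FluidPDE
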